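import Literature.AnabelianGeometry.SemiGraphs.ProSigmaCompletionExtend
import Literature.GroupTheory.CombinatorialGroupTheory.PuncturedSurfaceGroup
import Mathlib.GroupTheory.SemidirectProduct
import Mathlib.Algebra.Group.Equiv.TypeTags
import Mathlib.Topology.Algebra.Group.SubmonoidClosure
import Mathlib.Topology.Instances.ZMod
import Mathlib.Algebra.Group.TypeTags.Finite
import HarnessLib

/-!
# Non-abelian finite quotients of punctured surface groups: Heisenberg `ℓ`-groups, and the separation engine

[SemiAnbd] Example 2.10 (p. 31) / [CombGC] Prop. 1.2 (i) (p. 8): separating closed subgroups of the pro-`Σ`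
completion `ι : Γ_{g,r} → Π` of a punctured surface group by FINITE `Σ`-QUOTIENTS.  The abelian
quotients (`Γ_{g,r} → ℤ/ℓⁿ`, abc-iut-L3-t11's `exists_cuspCharacter`, abc-iut-f-164's
`exists_handleCuspCharacter`) separate elements with independent homology classes; an element that is
homologous to a cusp — e.g. the loop `ε = c_j · ∏_{i<g₀}[a_i,b_i]` around a node cutting off a component
with a single marked point `c_j` — needs a non-abelian `ℓ`-group.  This PROOF-ONLY file (abc-iut-f-164
gen 2; no definitions: every object is produced by an `∃`) supplies:

* `Heisenberg.exists_heisenbergTriple q`: inside the semidirect product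
  `(ℤ/q × ℤ/q) ⋊_φ ℤ/q` for the shear action `φ_a (b, c) = (b, c + a b)` (`exists_shearAction`) — the
  Heisenberg group of order `q³` — elements `X, Y, Z` with `X Y X⁻¹ Y⁻¹ = Z` and `Z^m = 1 ↔ q ∣ m`;
* `PuncturedSurfaceGroup.exists_hom_handle_cusp`: a homomorphism `Γ_{g,r} → Q` with ONE active handle
  `a_{i₀} ↦ X, b_{i₀} ↦ Y` and ONE active cusp `c_{j₀} ↦ W`, all other generators `↦ 1`, exists as soon as
  `X Y X⁻¹ Y⁻¹ · W = 1` (the relator), together with its value on the node loops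
  `(c_s ⋯ c_{r−1}) · ∏_{i<g₀}[a_i,b_i]` of the two-component shapes (`hom_handle_cusp_nodeLoop`);
* the target-free separation engine `PSCDatum.exists_pow_mem_of_isOpen_inf_subgroupOf`: in a compact
  group, if `S ∩ T` is open in `S` then every `x ∈ S` has a positive power in `T` (Mathlib's
  `mapClusterPt_one_atTop_pow`) — so openness is refuted by ONE homomorphism to ANY group killing `T`
  but not that power (abc-iut-f-165's `not_isOpen_inf_subgroupOf_of_characters` is the `ℤ/ℓⁿ` case);
* `IsProSigmaCompletion.exists_continuous_extend_heisenberg`: continuous extension to `Π` of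
  homomorphisms `Γ → (ℤ/ℓⁿ × ℤ/ℓⁿ) ⋊ ℤ/ℓⁿ` for `ℓ ∈ Σ` (order `ℓ^{3n}` is a `Σ`-integer).

Plain (pro)finite group theory; nothing here bears on [IUTchIII] Cor. 3.12.
[cite: MochizukiSemiAnbd2006, Ex. 2.10 p.31] [cite: MochizukiCombGC2007, Prop 1.2(i) p.8]
-/

noncomputable section

open Multiplicative

/-! ### The Heisenberg group of order `q³` as a semidirect product -/

namespace Literature.AnabelianGeometry.SemiGraphs.Heisenberg

open SemidirectProduct

/-- **The shear action** of `ℤ/q` on `ℤ/q × ℤ/q`, `φ_a(b, c) = (b, c + a·b)` (written multiplicatively),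
as a homomorphism to `MulAut` — the action defining the Heisenberg group `(ℤ/q × ℤ/q) ⋊ ℤ/q`.
[cite: MochizukiSemiAnbd2006, Ex. 2.10 p.31] -/
theorem exists_shearAction (q : ℕ) :
    ∃ φ : Multiplicative (ZMod q) →* MulAut (Multiplicative (ZMod q × ZMod q)),
      ∀ a v, φ a v = ofAdd ((toAdd v).1, (toAdd v).2 + toAdd a * (toAdd v).1) := by
  let sh : ZMod q → (ZMod q × ZMod q ≃+ ZMod q × ZMod q) := fun a =>
    { toFun := fun v => (v.1, v.2 + a * v.1)
      invFun := fun v => (v.1, v.2 - a * v.1)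
      left_inv := fun v => by ext <;> simp
      right_inv := fun v => by ext <;> simp
      map_add' := fun v w => by ext <;> simp only [Prod.fst_add, Prod.snd_add]; ring }
  refine ⟨{ toFun := fun a => AddEquiv.toMultiplicative (sh (toAdd a))
            map_one' := ?_
            map_mul' := fun a a' => ?_ }, fun a v => rfl⟩
  · ext v
    · rfl
    · change (toAdd v).2 + toAdd (1 : Multiplicative (ZMod q)) * (toAdd v).1 = (toAdd v).2
      rw [toAdd_one, zero_mul, add_zero]
  · ext v
    · rfl
    · change (toAdd v).2 + toAdd (a * a') * (toAdd v).1 =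
        ((toAdd v).2 + toAdd a' * (toAdd v).1) + toAdd a * (toAdd v).1
      rw [toAdd_mul]; ring

/-- **A Heisenberg triple**: in `H_q = (ℤ/q × ℤ/q) ⋊_φ ℤ/q` (`φ` the shear action) the elements
`X = (0; 1)`, `Y = ((1,0); 0)`, `Z = ((0,1); 0)` satisfy `X Y X⁻¹ Y⁻¹ = Z`, `Z^m = 1 ↔ q ∣ m`, and
`|H_q| = q³`. [cite: MochizukiSemiAnbd2006, Ex. 2.10 p.31] -/
theorem exists_heisenbergTriple (q : ℕ) :
    ∃ (φ : Multiplicative (ZMod q) →* MulAut (Multiplicative (ZMod q × ZMod q)))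
      (X Y Z : Multiplicative (ZMod q × ZMod q) ⋊[φ] Multiplicative (ZMod q)),
      X * Y * X⁻¹ * Y⁻¹ = Z ∧ (∀ m : ℕ, Z ^ m = 1 ↔ q ∣ m) ∧
        Nat.card (Multiplicative (ZMod q × ZMod q) ⋊[φ] Multiplicative (ZMod q)) = q ^ 3 := by
  obtain ⟨φ, hφ⟩ := exists_shearAction q
  refine ⟨φ, inr (ofAdd 1), inl (ofAdd (1, 0)), inl (ofAdd (0, 1)), ?_, fun m => ?_, ?_⟩
  · have h1 : (inr (ofAdd (1 : ZMod q)) : Multiplicative (ZMod q × ZMod q) ⋊[φ] Multiplicative (ZMod q)) *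
        inl (ofAdd (1, 0)) * (inr (ofAdd 1))⁻¹ = inl (ofAdd (1, 1)) := by
      rw [← map_inv, ← inl_aut, hφ]
      simp
    rw [h1, ← map_inv, ← map_mul, inl_inj, ← ofAdd_neg, ← ofAdd_add]
    simp
  · rw [← map_pow, ← (inl : _ →* Multiplicative (ZMod q × ZMod q) ⋊[φ] _).map_one, inl_inj,
      ← ofAdd_nsmul, ← ofAdd_zero, ofAdd.apply_eq_iff_eq, Prod.smul_mk, smul_zero, nsmul_eq_mul,
      mul_one, Prod.mk_eq_zero, eq_self_iff_true, true_and, ZMod.natCast_eq_zero_iff]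
  · rw [card, Nat.card_congr (toAdd : Multiplicative (ZMod q × ZMod q) ≃ _),
      Nat.card_congr (toAdd : Multiplicative (ZMod q) ≃ _), Nat.card_prod, Nat.card_zmod]
    ring

end Literature.AnabelianGeometry.SemiGraphs.Heisenberg


/-! ### Homomorphisms of `Γ_{g,r}` with one active handle and one active cusp -/

namespace Literature.GroupTheory.CombinatorialGroupTheory.PuncturedSurfaceGroup

variable {g r : ℕ}

/-- In a list without duplicates, a product whose factors are `1` except at one entry equals that
factor. [folklore] -/
private theorem prod_map_finRange_single {M : Type*} [Monoid M] {n : ℕ} (i₀ : Fin n) (F : Fin n → M)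
    (hF : ∀ i, i ≠ i₀ → F i = 1) : ((List.finRange n).map F).prod = F i₀ := by
  rw [List.prod_map_eq_pow_single i₀ F (fun i hi _ => hF i hi),
    List.count_eq_one_of_mem (List.nodup_finRange n) (List.mem_finRange i₀), pow_one]

/-- **Homomorphisms `Γ_{g,r} → Q` with one active handle and one active cusp.**  For `X, Y, W ∈ Q` with
`X Y X⁻¹ Y⁻¹ · W = 1` there is `ψ : Γ_{g,r} → Q` with `a_{i₀} ↦ X`, `b_{i₀} ↦ Y`, `c_{j₀} ↦ W` and every
other generator `↦ 1` (the relator `∏_i [a_i,b_i] · ∏_j c_j` maps to `[X,Y]·W = 1`).  The non-abelian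
finite quotients of surface groups used to separate a node loop from a homologous cusp.
[cite: MochizukiSemiAnbd2006, Ex. 2.10 p.31] -/
theorem exists_hom_handle_cusp {Q : Type*} [Group Q] (i₀ : Fin g) (j₀ : Fin r) (X Y W : Q)
    (h : X * Y * X⁻¹ * Y⁻¹ * W = 1) :
    ∃ ψ : PuncturedSurfaceGroup g r →* Q, ψ (a i₀) = X ∧ ψ (b i₀) = Y ∧ ψ (c j₀) = W ∧
      (∀ i, i ≠ i₀ → ψ (a i) = 1 ∧ ψ (b i) = 1) ∧ ∀ j, j ≠ j₀ → ψ (c j) = 1 := by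
  classical
  let f : puncturedSurfaceGen g r → Q :=
    Sum.elim (fun p => if p.1 = i₀ then (if p.2 then Y else X) else 1) fun j => if j = j₀ then W else 1
  have hrel : ∀ v ∈ ({relator g r} : Set (FreeGroup (puncturedSurfaceGen g r))),
      FreeGroup.lift f v = 1 := by
    intro v hv
    rw [Set.mem_singleton_iff] at hv
    subst hv
    simp only [relator, map_mul, map_list_prod, List.map_map, Function.comp_def, map_inv, genA, genB,
      genC, FreeGroup.lift_apply_of]
    rw [prod_map_finRange_single i₀ _ (fun i hi => by simp [f, hi]),
      prod_map_finRange_single j₀ _ (fun j hj => by simp [f, hj])]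
    simpa [f] using h
  refine ⟨PresentedGroup.toGroup hrel, ?_, ?_, ?_, fun i hi => ⟨?_, ?_⟩, fun j hj => ?_⟩
  · rw [a, PresentedGroup.toGroup.of]; simp [f]
  · rw [b, PresentedGroup.toGroup.of]; simp [f]
  · rw [c, PresentedGroup.toGroup.of]; simp [f]
  · rw [a, PresentedGroup.toGroup.of]; simp [f, hi]
  · rw [b, PresentedGroup.toGroup.of]; simp [f, hi]
  · rw [c, PresentedGroup.toGroup.of]; simp [f, hj]

/-- **Such a homomorphism on the node loop** `ε = (c_s ⋯ c_{r−1}) · ∏_{i<g₀}[a_i,b_i]` of the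
two-component shapes: `ψ(ε) = W^{[s ≤ j₀]} · [X,Y]^{[i₀ < g₀]}`.
[cite: MochizukiCombGC2007, Prop 1.2(i) p.8] -/
theorem hom_handle_cusp_nodeLoop {Q : Type*} [Group Q] {i₀ : Fin g} {j₀ : Fin r} {X Y W : Q}
    (ψ : PuncturedSurfaceGroup g r →* Q) (ha : ψ (a i₀) = X) (hb : ψ (b i₀) = Y) (hc : ψ (c j₀) = W)
    (hab : ∀ i, i ≠ i₀ → ψ (a i) = 1 ∧ ψ (b i) = 1) (hc' : ∀ j, j ≠ j₀ → ψ (c j) = 1) (g₀ s : ℕ) :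
    ψ (((List.finRange r).map fun j : Fin r => if s ≤ (j : ℕ) then c (g := g) j else 1).prod *
        ((List.finRange g).map fun i : Fin g =>
          if (i : ℕ) < g₀ then a (r := r) i * b i * (a i)⁻¹ * (b i)⁻¹ else 1).prod) =
      (if s ≤ (j₀ : ℕ) then W else 1) * (if (i₀ : ℕ) < g₀ then X * Y * X⁻¹ * Y⁻¹ else 1) := by
  classical
  have hC : ∀ j, j ≠ j₀ → (ψ ∘ fun j : Fin r => if s ≤ (j : ℕ) then c (g := g) j else 1) j = 1 :=
    fun j hj => by simp only [Function.comp_apply, apply_ite ψ, map_one, hc' j hj, ite_self]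
  have hA : ∀ i, i ≠ i₀ → (ψ ∘ fun i : Fin g =>
      if (i : ℕ) < g₀ then a (r := r) i * b i * (a i)⁻¹ * (b i)⁻¹ else 1) i = 1 := fun i hi => by
    simp only [Function.comp_apply, apply_ite ψ, map_one, map_mul, map_inv, (hab i hi).1, (hab i hi).2,
      inv_one, mul_one, ite_self]
  rw [map_mul, map_list_prod, map_list_prod, List.map_map, List.map_map,
    prod_map_finRange_single j₀ _ hC, prod_map_finRange_single i₀ _ hA]
  simp only [Function.comp_apply, apply_ite ψ, map_one, map_mul, map_inv, ha, hb, hc]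

end Literature.GroupTheory.CombinatorialGroupTheory.PuncturedSurfaceGroup

/-! ### The target-free separation engine -/

namespace Literature.AnabelianGeometry.SemiGraphs

open scoped Pointwise
open Literature.AnabelianGeometry.Anabelioids (IsSigmaInteger)

namespace PSCDatum

variable {P : Type*} [Group P] [TopologicalSpace P] [IsTopologicalGroup P]

/-- **In a compact group, if `S ∩ T` is open in `S`, then every `x ∈ S` has a positive power in `T`**
(`1` is a cluster point of `(x^n)_{n ≥ 1}` — Mathlib's `mapClusterPt_one_atTop_pow` — and `S ∩ T` is a
neighbourhood of `1` in `S`).  Openness in [CombGC] Prop. 1.2 (i) is refuted by ONE homomorphism to ANY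
group killing `T` but not that power (abc-iut-f-165's `not_isOpen_inf_subgroupOf_of_characters` is the
`ℤ/ℓⁿ`-valued case). [cite: MochizukiCombGC2007, Prop 1.2(i) p.8] -/
theorem exists_pow_mem_of_isOpen_inf_subgroupOf [CompactSpace P] {S T : Subgroup P} {x : P}
    (hx : x ∈ S) (hopen : IsOpen (((S ⊓ T).subgroupOf S : Subgroup S) : Set S)) :
    ∃ m : ℕ, 0 < m ∧ x ^ m ∈ T := by
  obtain ⟨W, hWo, hW⟩ := isOpen_induced_iff.mp hopen
  have h1W : (1 : P) ∈ W := by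
    have h1 : (⟨1, S.one_mem⟩ : S) ∈ Subtype.val ⁻¹' W := by
      rw [hW]; exact Subgroup.one_mem _
    exact h1
  have hfreq : ∃ᶠ n in Filter.atTop, x ^ n ∈ W :=
    (mapClusterPt_one_atTop_pow x).frequently (hWo.mem_nhds h1W)
  obtain ⟨m, hm, hxm⟩ := Filter.frequently_atTop.mp hfreq 1
  refine ⟨m, hm, ?_⟩
  have hmem : (⟨x ^ m, S.pow_mem hx m⟩ : S) ∈ Subtype.val ⁻¹' W := hxm
  rw [hW] at hmem
  exact (Subgroup.mem_inf.mp (Subgroup.mem_subgroupOf.mp hmem)).2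

omit [TopologicalSpace P] [IsTopologicalGroup P] in
/-- A homomorphism killing `T` but not `x ^ m` shows `x ^ m ∉ T`. [cite: MochizukiCombGC2007, Prop 1.2(i) p.8] -/
theorem pow_notMem_of_hom {Q : Type*} [Group Q] (q : P →* Q) {T : Subgroup P} (hT : T ≤ q.ker) {x : P}
    {m : ℕ} (hx : q x ^ m ≠ 1) : x ^ m ∉ T := fun h => hx (by rw [← map_pow]; exact hT h)

end PSCDatum

/-! ### Continuous extension of Heisenberg-valued homomorphisms along a pro-`Σ` completion -/

namespace SemiGraphOfAnabelioids.IsProSigmaCompletion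

variable {P : Type*} [Group P] [TopologicalSpace P] [IsTopologicalGroup P] [CompactSpace P]
  [TotallyDisconnectedSpace P] {Sigma : Set ℕ} {Γ : Type*} [Group Γ] {ι : Γ →* P}

/-- **Extension of homomorphisms to a finite group of order `ℓ^k`, `ℓ ∈ Σ`**, along a pro-`Σ`
completion (`exists_continuous_extend_top`; `ℓ^k` is a `Σ`-integer). [cite: MochizukiSemiAnbd2006, Ex. 2.10 p.31] -/
theorem exists_continuous_extend_of_card_primePow (hι : IsProSigmaCompletion Sigma ι) {ℓ : ℕ}
    (hℓ : ℓ.Prime) (hℓS : ℓ ∈ Sigma) {Q : Type*} [Group Q] [Finite Q] [TopologicalSpace Q]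
    [DiscreteTopology Q] {k : ℕ} (hQ : Nat.card Q = ℓ ^ k) (f : Γ →* Q) :
    ∃ F : P →* Q, Continuous F ∧ ∀ γ, F (ι γ) = f γ :=
  hι.exists_continuous_extend_top ⟨by rw [hQ]; exact pow_pos hℓ.pos k, fun p hp hdvd =>
    ((Nat.prime_dvd_prime_iff_eq hp hℓ).mp (hp.dvd_of_dvd_pow (hQ ▸ hdvd))) ▸ hℓS⟩ f

end SemiGraphOfAnabelioids.IsProSigmaCompletion

end Literature.AnabelianGeometry.SemiGraphs

end
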